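import Mathlib
import HarnessLib
import Summits.AtomisticToContinuum.Crystallization.Theorems.PricedLinkCensusSoftFourRingsCapCertBonds

/-!
# Bond-to-cap certificate: soundness: from the three dominations `D ≤ α`, `O_b ≤ β_b`, `O_n ≤ β_n` on their domains and `12α + 48β_b + 84β_n + c₀ < 0` to the conclusion (`exists_inner_gt_of_dominated`), and the checker front-end `exists_inner_gt_of_checkAll`

Route `PricedLinkCensus`, item `SoftFourRings` (stmt-AtomisticToContinuum-14234), crux `Cap.BondToCap`
(seat c3).  Part 4/5 of the semantics-and-soundness layer of the certificate checker
(`PricedLinkCensusSoftFourRingsCapCertComp`).  Master valid inequality, for a unit pole `p ∉ X` and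
unit vectors `X` (`u_x = ⟪p,x⟫`, `t_xy = ⟪x,y⟫`): `Σ_{x,y∈X} Ocore(u_x,u_y,t_xy) + Σ_x Dcross(u_x) + c₀ ≥ 0`;
splitting at each `x` into the diagonal, four bonded and seven non-bonded terms and moving the free
polynomials with the degree identities gives `0 ≤ Σ D + Σ O_b + Σ O_n + c₀ ≤ 12α + 48β_b + 84β_n + c₀ < 0`.
-/

namespace Summit.AtomisticToContinuum.Crystallization.Theorems.Cap.Cert

open Real RealInnerProductSpace Finset
open Literature.Geometry.DiscreteGeometry Literature.Geometry.DiscreteGeometry.PolyCert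
  Literature.Geometry.DiscreteGeometry.PolyCert.SPoly

/-! ### Soundness -/

/-- From a residual check: the scaled bound dominates the function wherever the multipliers are
nonnegative. [folklore] -/
theorem le_of_residualCheck (S : ℕ) (bound : ℤ) (P : SPoly) (ms : List SPoly) (gs : List GramBlk)
    (cslack : ℕ) (hg : gramsOK ms gs = true)
    (h : residualBound (smul (4 ^ S) (C bound ++ neg P) ++ neg (sosPoly ms gs) ++ neg (C cslack))
      cslack = true)
    {u v t : ℝ} (hu : |u| ≤ 1) (hv : |v| ≤ 1) (ht : |t| ≤ 1) (hms : ∀ m ∈ ms, 0 ≤ eval m u v t) :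
    eval P u v t ≤ bound := by
  have hr := abs_eval_le_of_residualBound _ _ h hu hv ht
  simp only [eval_append, eval_smul, eval_C, eval_neg] at hr
  have hsos := eval_sosPoly_nonneg ms gs hg u v t hms
  have h4 : (0 : ℝ) < (4 : ℝ) ^ S := by positivity
  have hle := (abs_le.1 hr).1
  push_cast at hle
  nlinarith

/-- **Soundness of the checker.**  If `checkAll c = true` then, for twelve unit directions `X`,
pairwise at cosine `≤ 1 − 1/(2·1.01²)`, with bonds `B` (cosine `≥ 1 − 1.01²/2`, four at every point)
and non-bonds at cosine `< 1.01/2`, every unit vector `p` has a direction `x ∈ X` with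
`⟪p, x⟫ > cbN/cbD`. -/
theorem exists_inner_gt_of_dominated (c : CapCert) (hcbD : 0 < c.cbD) (hcb1 : c.cbN < c.cbD)
    (hF : 12 * c.alpha + 48 * c.betab + 84 * c.betan + c0Of c.lb < 0)
    (HD : ∀ u v t : ℝ, |u| ≤ 1 → |v| ≤ 1 → |t| ≤ 1 → (∀ m ∈ multD c, 0 ≤ eval m u v t) →
      eval (DPoly c) u v t ≤ c.alpha)
    (HB : ∀ u v t : ℝ, |u| ≤ 1 → |v| ≤ 1 → |t| ≤ 1 → (∀ m ∈ multB c, 0 ≤ eval m u v t) →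
      eval (ObPoly c) u v t ≤ c.betab)
    (HN : ∀ u v t : ℝ, |u| ≤ 1 → |v| ≤ 1 → |t| ≤ 1 → (∀ m ∈ multN c, 0 ≤ eval m u v t) →
      eval (OnPoly c) u v t ≤ c.betan)
    {X : Finset (EuclideanSpace ℝ (Fin 3))} {B : Finset (Finset (EuclideanSpace ℝ (Fin 3)))}
    (hX1 : ∀ y ∈ X, ‖y‖ = 1) (hcard : X.card = 12)
    (hsep : ∀ u ∈ X, ∀ u' ∈ X, u ≠ u' → ⟪u, u'⟫ ≤ 1 - 1 / (2 * (101 / 100 : ℝ) ^ 2))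
    (hB : ∀ T ∈ B, ∃ u ∈ X, ∃ u' ∈ X, u ≠ u' ∧ 1 - (101 / 100 : ℝ) ^ 2 / 2 ≤ ⟪u, u'⟫ ∧ T = {u, u'})
    (hdeg : ∀ v ∈ X, ∃ w : Fin 4 → EuclideanSpace ℝ (Fin 3), (∀ k, w k ∈ X) ∧
      Function.Injective w ∧ (∀ k, w k ≠ v) ∧
      (∀ k, ({v, w k} : Finset (EuclideanSpace ℝ (Fin 3))) ∈ B) ∧
      ∀ y, ({v, y} : Finset (EuclideanSpace ℝ (Fin 3))) ∈ B → ∃ k, y = w k)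
    (hnb : ∀ u ∈ X, ∀ u' ∈ X, u ≠ u' → ({u, u'} : Finset (EuclideanSpace ℝ (Fin 3))) ∉ B →
      ⟪u, u'⟫ < 101 / 200)
    (p : EuclideanSpace ℝ (Fin 3)) (hp : ‖p‖ = 1) :
    ∃ x ∈ X, (c.cbN : ℝ) < c.cbD * ⟪p, x⟫ := by
  classical
  by_contra hcon
  push Not at hcon
  -- basic facts
  have hcbD' : (0 : ℝ) < c.cbD := by exact_mod_cast hcbD
  have hpX : p ∉ X := by
    intro hpX
    have h1 := hcon p hpX
    rw [real_inner_self_eq_norm_sq, hp] at h1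
    have : (c.cbN : ℝ) < c.cbD := by exact_mod_cast hcb1
    linarith
  have habs : ∀ x ∈ X, ∀ y ∈ X, |⟪x, y⟫| ≤ 1 := fun x hx y hy => by
    have := abs_real_inner_le_norm x y; rw [hX1 x hx, hX1 y hy] at this; linarith
  have hpabs : ∀ x ∈ X, |⟪p, x⟫| ≤ 1 := fun x hx => by
    have := abs_real_inner_le_norm p x; rw [hp, hX1 x hx] at this; linarith
  have hqU : ∀ x ∈ X, 0 ≤ (1 + ⟪p, x⟫) * (c.cbN - c.cbD * ⟪p, x⟫) := fun x hx =>
    mul_nonneg (by linarith [(abs_le.1 (hpabs x hx)).1]) (by linarith [hcon x hx])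
  -- pointwise bounds from the three identities
  set u : EuclideanSpace ℝ (Fin 3) → ℝ := fun x => ⟪p, x⟫ with hu
  have hDle : ∀ x ∈ X, eval (DPoly c) (u x) (u x) 1 ≤ c.alpha := by
    intro x hx
    refine HD _ _ _ (hpabs x hx) (hpabs x hx) (by norm_num) ?_
    intro m hm
    simp only [multD, List.mem_cons, List.mem_nil_iff, or_false] at hm
    rcases hm with rfl | rfl
    · simp
    · rw [eval_qU]; exact hqU x hx
  have hOble : ∀ x ∈ X, ∀ y ∈ X, ({x, y} : Finset (EuclideanSpace ℝ (Fin 3))) ∈ B →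
      eval (ObPoly c) (u x) (u y) ⟪x, y⟫ ≤ c.betab := by
    intro x hx y hy hxy
    have hne := ne_of_mem_bonds hB hxy
    have htb := inner_ge_of_bond hB hxy
    have hta := hsep x hx y hy hne
    refine HB _ _ _ (hpabs x hx) (hpabs y hy) (habs x hx y hy) ?_
    intro m hm
    simp only [multB, List.mem_cons, List.mem_nil_iff, or_false] at hm
    rcases hm with rfl | rfl | rfl | rfl | rfl | rfl
    · simp
    · rw [eval_qU]; exact hqU x hx
    · rw [eval_qV]; exact hqU y hy
    · rw [eval_qTb]
      refine mul_nonneg ?_ ?_ <;> nlinarith [htb, hta]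
    · rw [eval_qUV]; exact mul_nonneg (by linarith [hcon x hx]) (by linarith [hcon y hy])
    · rw [eval_p4]; nlinarith [gram_nonneg hp (hX1 x hx) (hX1 y hy)]
  have hOnle : ∀ x ∈ X, ∀ y ∈ X, y ≠ x → ({x, y} : Finset (EuclideanSpace ℝ (Fin 3))) ∉ B →
      eval (OnPoly c) (u x) (u y) ⟪x, y⟫ ≤ c.betan := by
    intro x hx y hy hne hxy
    have htn := hnb x hx y hy hne.symm hxy
    have ht1 := (abs_le.1 (habs x hx y hy)).1
    refine HN _ _ _ (hpabs x hx) (hpabs y hy) (habs x hx y hy) ?_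
    intro m hm
    simp only [multN, List.mem_cons, List.mem_nil_iff, or_false] at hm
    rcases hm with rfl | rfl | rfl | rfl | rfl | rfl
    · simp
    · rw [eval_qU]; exact hqU x hx
    · rw [eval_qV]; exact hqU y hy
    · rw [eval_qTn]; exact mul_nonneg (by linarith) (by linarith)
    · rw [eval_qUV]; exact mul_nonneg (by linarith [hcon x hx]) (by linarith [hcon y hy])
    · rw [eval_p4]; nlinarith [gram_nonneg hp (hX1 x hx) (hX1 y hy)]
  -- the master inequality and its rearrangement
  have hM := master_nonneg c hp hX1 hpX
  set Oc : ℝ → ℝ → ℝ → ℝ := fun a b s => eval (OcorePoly c) a b s with hOc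
  have hDeval : ∀ x ∈ X, eval (DPoly c) (u x) (u x) 1 =
      Oc (u x) (u x) 1 + LcoupDval c.lb (u x) - 8 * phiW c.hb (u x) - 14 * phiW c.hn (u x) := by
    intro x _
    simp only [DPoly, eval_append, eval_substUU1, eval_LcoupDPoly, eval_smul, eval_phiU, hOc]
    push_cast; ring
  have hObeval : ∀ a b s : ℝ, eval (ObPoly c) a b s = Oc a b s + phiW c.hb a + phiW c.hb b := by
    intro a b s; simp only [ObPoly, eval_append, eval_phiU, eval_phiV, hOc]
  have hOneval : ∀ a b s : ℝ, eval (OnPoly c) a b s = Oc a b s + phiW c.hn a + phiW c.hn b := by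
    intro a b s; simp only [OnPoly, eval_append, eval_phiU, eval_phiV, hOc]
  -- split Σ_y at each x
  have hsplit : ∀ x ∈ X, ∑ y ∈ X, Oc (u x) (u y) ⟪x, y⟫ = Oc (u x) (u x) 1 +
      ∑ y ∈ X.filter (fun y => ({x, y} : Finset (EuclideanSpace ℝ (Fin 3))) ∈ B), Oc (u x) (u y) ⟪x, y⟫ +
      ∑ y ∈ X.filter (fun y => y ≠ x ∧ ({x, y} : Finset (EuclideanSpace ℝ (Fin 3))) ∉ B),
        Oc (u x) (u y) ⟪x, y⟫ := by
    intro x hx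
    rw [sum_split_bond hB hx (fun y => Oc (u x) (u y) ⟪x, y⟫)]
    have hxx : ⟪x, x⟫ = 1 := by rw [real_inner_self_eq_norm_sq, hX1 x hx]; norm_num
    rw [hxx]
  -- bounded sums
  have hSD : ∑ x ∈ X, eval (DPoly c) (u x) (u x) 1 ≤ 12 * c.alpha := by
    have := Finset.sum_le_card_nsmul X (fun x => eval (DPoly c) (u x) (u x) 1) (c.alpha : ℝ) hDle
    rw [hcard] at this
    simp only [nsmul_eq_mul, Nat.cast_ofNat] at this
    linarith
  have hSB : ∑ x ∈ X, ∑ y ∈ X.filter (fun y => ({x, y} : Finset (EuclideanSpace ℝ (Fin 3))) ∈ B),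
      eval (ObPoly c) (u x) (u y) ⟪x, y⟫ ≤ 48 * c.betab := by
    have h4 : ∀ x ∈ X, ∑ y ∈ X.filter (fun y => ({x, y} : Finset (EuclideanSpace ℝ (Fin 3))) ∈ B),
        eval (ObPoly c) (u x) (u y) ⟪x, y⟫ ≤ 4 * (c.betab : ℝ) := by
      intro x hx
      obtain ⟨w, hwX, hwinj, -, hwB, hall⟩ := hdeg x hx
      have := Finset.sum_le_card_nsmul
        (X.filter (fun y => ({x, y} : Finset (EuclideanSpace ℝ (Fin 3))) ∈ B))
        (fun y => eval (ObPoly c) (u x) (u y) ⟪x, y⟫) (c.betab : ℝ)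
        (fun y hy => by
          have h' := Finset.mem_filter.1 hy
          exact hOble x hx y h'.1 h'.2)
      rw [card_filter_bond_eq_four hwX hwinj hwB hall] at this
      simp only [nsmul_eq_mul, Nat.cast_ofNat] at this
      linarith
    have := Finset.sum_le_card_nsmul X _ (4 * (c.betab : ℝ)) h4
    rw [hcard] at this
    simp only [nsmul_eq_mul, Nat.cast_ofNat] at this
    linarith
  have hSN : ∑ x ∈ X, ∑ y ∈ X.filter (fun y => y ≠ x ∧ ({x, y} : Finset (EuclideanSpace ℝ (Fin 3))) ∉ B),
      eval (OnPoly c) (u x) (u y) ⟪x, y⟫ ≤ 84 * c.betan := by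
    have h7 : ∀ x ∈ X, ∑ y ∈ X.filter (fun y => y ≠ x ∧ ({x, y} : Finset (EuclideanSpace ℝ (Fin 3))) ∉ B),
        eval (OnPoly c) (u x) (u y) ⟪x, y⟫ ≤ 7 * (c.betan : ℝ) := by
      intro x hx
      obtain ⟨w, hwX, hwinj, -, hwB, hall⟩ := hdeg x hx
      have := Finset.sum_le_card_nsmul
        (X.filter (fun y => y ≠ x ∧ ({x, y} : Finset (EuclideanSpace ℝ (Fin 3))) ∉ B))
        (fun y => eval (OnPoly c) (u x) (u y) ⟪x, y⟫) (c.betan : ℝ)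
        (fun y hy => by
          have h' := Finset.mem_filter.1 hy
          exact hOnle x hx y h'.1 h'.2.1 h'.2.2)
      rw [card_filter_nonbond_eq_seven hcard hB hx hwX hwinj hwB hall] at this
      simp only [nsmul_eq_mul, Nat.cast_ofNat] at this
      linarith
    have := Finset.sum_le_card_nsmul X _ (7 * (c.betan : ℝ)) h7
    rw [hcard] at this
    simp only [nsmul_eq_mul, Nat.cast_ofNat] at this
    linarith
  -- the h-identities
  have hHb := sum_sum_bond_right hdeg (fun y => phiW c.hb (u y))
  have hHn := sum_sum_nonbond_right hcard hB hdeg (fun y => phiW c.hn (u y))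
  have hHb' : ∑ x ∈ X, ∑ y ∈ X.filter (fun y => ({x, y} : Finset (EuclideanSpace ℝ (Fin 3))) ∈ B),
      phiW c.hb (u x) = 4 * ∑ x ∈ X, phiW c.hb (u x) := by
    rw [Finset.mul_sum]
    refine Finset.sum_congr rfl fun x hx => ?_
    obtain ⟨w, hwX, hwinj, -, hwB, hall⟩ := hdeg x hx
    rw [Finset.sum_const, card_filter_bond_eq_four hwX hwinj hwB hall]; simp
  have hHn' : ∑ x ∈ X, ∑ y ∈ X.filter (fun y => y ≠ x ∧ ({x, y} : Finset (EuclideanSpace ℝ (Fin 3))) ∉ B),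
      phiW c.hn (u x) = 7 * ∑ x ∈ X, phiW c.hn (u x) := by
    rw [Finset.mul_sum]
    refine Finset.sum_congr rfl fun x hx => ?_
    obtain ⟨w, hwX, hwinj, -, hwB, hall⟩ := hdeg x hx
    rw [Finset.sum_const, card_filter_nonbond_eq_seven hcard hB hx hwX hwinj hwB hall]; simp
  -- total: master = Σ D + ΣΣ Ob + ΣΣ On + c0
  have hfinal : (12 * c.alpha + 48 * c.betab + 84 * c.betan + c0Of c.lb : ℝ) < 0 := by
    exact_mod_cast hF
  -- component identities
  have ea : ∑ x ∈ X, ∑ y ∈ X, Oc (u x) (u y) ⟪x, y⟫ = ∑ x ∈ X, Oc (u x) (u x) 1 +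
      ∑ x ∈ X, ∑ y ∈ X.filter (fun y => ({x, y} : Finset (EuclideanSpace ℝ (Fin 3))) ∈ B), Oc (u x) (u y) ⟪x, y⟫ +
      ∑ x ∈ X, ∑ y ∈ X.filter (fun y => y ≠ x ∧ ({x, y} : Finset (EuclideanSpace ℝ (Fin 3))) ∉ B),
        Oc (u x) (u y) ⟪x, y⟫ := by
    rw [Finset.sum_congr rfl hsplit, Finset.sum_add_distrib, Finset.sum_add_distrib]
  have eb : ∑ x ∈ X, eval (DPoly c) (u x) (u x) 1 = ∑ x ∈ X, Oc (u x) (u x) 1 +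
      ∑ x ∈ X, LcoupDval c.lb (u x) - 8 * ∑ x ∈ X, phiW c.hb (u x) - 14 * ∑ x ∈ X, phiW c.hn (u x) := by
    rw [Finset.sum_congr rfl hDeval, Finset.sum_sub_distrib, Finset.sum_sub_distrib,
      Finset.sum_add_distrib, Finset.mul_sum, Finset.mul_sum]
  have ec : ∑ x ∈ X, ∑ y ∈ X.filter (fun y => ({x, y} : Finset (EuclideanSpace ℝ (Fin 3))) ∈ B),
      eval (ObPoly c) (u x) (u y) ⟪x, y⟫ =
      ∑ x ∈ X, ∑ y ∈ X.filter (fun y => ({x, y} : Finset (EuclideanSpace ℝ (Fin 3))) ∈ B), Oc (u x) (u y) ⟪x, y⟫ +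
      8 * ∑ x ∈ X, phiW c.hb (u x) := by
    simp_rw [hObeval, Finset.sum_add_distrib]
    rw [hHb, hHb']; ring
  have ed : ∑ x ∈ X, ∑ y ∈ X.filter (fun y => y ≠ x ∧ ({x, y} : Finset (EuclideanSpace ℝ (Fin 3))) ∉ B),
      eval (OnPoly c) (u x) (u y) ⟪x, y⟫ =
      ∑ x ∈ X, ∑ y ∈ X.filter (fun y => y ≠ x ∧ ({x, y} : Finset (EuclideanSpace ℝ (Fin 3))) ∉ B),
        Oc (u x) (u y) ⟪x, y⟫ + 14 * ∑ x ∈ X, phiW c.hn (u x) := by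
    simp_rw [hOneval, Finset.sum_add_distrib]
    rw [hHn, hHn']; ring
  have hM' : 0 ≤ ∑ x ∈ X, ∑ y ∈ X, Oc (u x) (u y) ⟪x, y⟫ + ∑ x ∈ X, LcoupDval c.lb (u x) +
      (c0Of c.lb : ℝ) := hM
  linarith [ea, eb, ec, ed]

/-- **Soundness of the checker** (all three Gram evaluations inside the checks). -/
theorem exists_inner_gt_of_checkAll (c : CapCert) (hc : checkAll c = true)
    {X : Finset (EuclideanSpace ℝ (Fin 3))} {B : Finset (Finset (EuclideanSpace ℝ (Fin 3)))}
    (hX1 : ∀ y ∈ X, ‖y‖ = 1) (hcard : X.card = 12)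
    (hsep : ∀ u ∈ X, ∀ u' ∈ X, u ≠ u' → ⟪u, u'⟫ ≤ 1 - 1 / (2 * (101 / 100 : ℝ) ^ 2))
    (hB : ∀ T ∈ B, ∃ u ∈ X, ∃ u' ∈ X, u ≠ u' ∧ 1 - (101 / 100 : ℝ) ^ 2 / 2 ≤ ⟪u, u'⟫ ∧ T = {u, u'})
    (hdeg : ∀ v ∈ X, ∃ w : Fin 4 → EuclideanSpace ℝ (Fin 3), (∀ k, w k ∈ X) ∧
      Function.Injective w ∧ (∀ k, w k ≠ v) ∧
      (∀ k, ({v, w k} : Finset (EuclideanSpace ℝ (Fin 3))) ∈ B) ∧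
      ∀ y, ({v, y} : Finset (EuclideanSpace ℝ (Fin 3))) ∈ B → ∃ k, y = w k)
    (hnb : ∀ u ∈ X, ∀ u' ∈ X, u ≠ u' → ({u, u'} : Finset (EuclideanSpace ℝ (Fin 3))) ∉ B →
      ⟪u, u'⟫ < 101 / 200)
    (p : EuclideanSpace ℝ (Fin 3)) (hp : ‖p‖ = 1) :
    ∃ x ∈ X, (c.cbN : ℝ) < c.cbD * ⟪p, x⟫ := by
  simp only [checkAll, Bool.and_eq_true, decide_eq_true_eq] at hc
  obtain ⟨⟨⟨⟨⟨hcbD, hcb1⟩, hD⟩, hBc⟩, hNc⟩, hF⟩ := hc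
  simp only [checkD, checkB, checkN, checkFinal, Bool.and_eq_true, decide_eq_true_eq] at hD hBc hNc hF
  exact exists_inner_gt_of_dominated c hcbD hcb1 hF
    (fun u v t hu hv ht hms => le_of_residualCheck c.S c.alpha (DPoly c) (multD c) c.gD c.cD hD.1 hD.2
      hu hv ht hms)
    (fun u v t hu hv ht hms => le_of_residualCheck c.S c.betab (ObPoly c) (multB c) c.gb c.cB hBc.1
      hBc.2 hu hv ht hms)
    (fun u v t hu hv ht hms => le_of_residualCheck c.S c.betan (OnPoly c) (multN c) c.gn c.cN hNc.1
      hNc.2 hu hv ht hms)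
    hX1 hcard hsep hB hdeg hnb p hp

end Summit.AtomisticToContinuum.Crystallization.Theorems.Cap.Cert
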